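import Summits.Ventures.QEC.Census.BB.BB432Data
import Summits.Ventures.QEC.Census.RankRREF
import HarnessLib

/-!
# `[[432,4,≤22]]` (BB.bb432): `rank₂ H^X = 214` (kernel tier, masks-only RREF certificate)

`BB.bb432` = the bivariate-bicycle code `QC(x + y¹¹ + y³, y² + x¹⁵ + x)` on `ℤ₁₈ × ℤ₁₂` of [BravyiEtAl2024, §5] (arXiv:2308.07915
chunk p0011 L48: "the `[[432,4,≤22]]` code with `ℓ,m = 18,12` and `A = x+y^{11}+y^3`, `B = y^2+x^{15}+x`"), typed as `BB.Code 18 12` in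
`Literature/InformationTheory/QuantumCodes/BivariateBicycleCodesSection5.lean`; the paper prints `[[432,4,≤22]]` (distance as an upper
bound only). (Header provenance corrected 2026-08-27 after qec-ref-2's reading bounce: an earlier version carried a Panteleev–Kalachev
template sentence; no declaration changed.)
This file: the reduced rows of `H^X` are DERIVED in the kernel as `maskX.map (xorMaskL (rowsX la lb))` from the data of
`BB432Data.lean`; ONE `decide +kernel` checks unit pivot columns (`pivotsOK`) and the re-assembly of every check row (`redSelL`);
`rank_rowMatrix_of_derived` (`Census/RankRREF.lean`) gives the rank, transported to the typed matrix along `rowsX_obj`.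
Tier KERNEL; no `native_decide`; axioms standard. HONEST FRAMING: a rank only.
-/

namespace Summit.Ventures.QEC.Census.BB432

open Matrix Literature.InformationTheory.QuantumCodes BBRows

/-- The reduced rows of `H^X`, DERIVED in the kernel from the masks. (definition) -/
def redKX : List ℕ := maskX.map (xorMaskL (rowsX la lb))

set_option maxRecDepth 100000 in
/-- The masks-only RREF certificate of `H^X` passes: unit pivot columns of the derived reduced rows AND re-assembly of all 216
check rows from their pivot bits (ONE `decide +kernel`, tier KERNEL). -/
theorem coreX_ok : (pivotsOK 432 pivX redKX &&
    ((rowsX la lb).all fun h => redSelL pivX redKX h == h)) = true := by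
  decide +kernel

set_option maxHeartbeats 2000000 in -- large index types met by the rewrite
set_option maxRecDepth 100000 in
/-- **`rank₂ H^X (BB.bb432) = 214`** (CERTIFIED, kernel tier). -/
theorem rank_HXFlat : BB.bb432.HXFlat.rank = 214 := by
  have h := coreX_ok
  rw [Bool.and_eq_true] at h
  rw [← rowsX_obj]
  exact rank_rowMatrix_of_derived (by decide) h.1 h.2

end Summit.Ventures.QEC.Census.BB432
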